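import Literature.Algebra.Homology.LaurentCechIdealSheafSequence
import Literature.Algebra.Homology.LaurentCechCompleteIntersectionCodim
import Literature.AlgebraicGeometry.HodgeTheory.ProjectiveSpaceBottFormulaGlobalSections
import HarnessLib

/-!
# `h¹(𝓘(d)) = h⁰(𝒪_X(d)) - dim S_d + dim Ī_d`: the `d`-normality defect (Hartshorne III Ex. 5.5, II Ex. 5.14)

Hartshorne, *Algebraic Geometry*, II Ex. 5.14 (d) / III Ex. 5.5 (a): for a closed subscheme
`X = V(I) ⊆ ℙ^r` the natural maps `S_d = Γ(ℙ^r, 𝒪(d)) → Γ(X, 𝒪_X(d))` are surjective for all `d`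
("`X` is projectively normal" for normal `X`; true for complete intersections) iff `H¹(ℙ^r, 𝓘_X(d)) = 0`
for all `d` — the long exact sequence of `0 → 𝓘_X → 𝒪_{ℙ^r} → 𝒪_X → 0` with `H¹(ℙ^r, 𝒪(d)) = 0`
(`r ≥ 2`). The kernel of `S_d → Γ(X, 𝒪_X(d))` is the degree-`d` piece of the saturation `Ī`
(II Ex. 5.10).

The tree has the qualitative statements (`LaurentCechIdealSheafSequence`:
`nonempty_quotient_range_linearEquiv_homology_one` — `coker(H⁰(Č_d(F_e)) → H⁰(Č_d(F_e ⧸ K))) ≅ H¹(Č_d(K))`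
for `r ≥ 2` — and `surjective_alphaH0_iff_isZero_homology_one`; `ker α_d = K̄_d`,
`LaurentCechGradedModuleGlobalSections.ker_alphaH0`). This file records the resulting NUMERICAL
formula over a field (`K ⊆ F_e` graded, `J` finite, `r ≥ 2`, every twist `d`):

* **`LaurentCech.finrank_homology_cech_one_add`** —
  `h¹(Č_d(K)) + dim (F_e)_d = h⁰(Č_d(F_e ⧸ K)) + dim K̄_d`, i.e.
  **`h¹(K~(d)) = h⁰((F_e ⧸ K)~(d)) - dim (F_e ⧸ K̄)_d`** — the number of independent global sections of
  `(F_e ⧸ K)~(d)` not cut out by `(F_e)_d`;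
* `LaurentCech.finrank_homology_cech_one_add_choose` — for `X = V(I) ⊆ ℙ^r` and `d ≥ 0`:
  **`h¹(𝓘_X(d)) + C(d + r, r) = h⁰(𝒪_X(d)) + dim Ī_d`**; e.g. `d = 1`: `X` is linearly normal iff
  `h⁰(𝒪_X(1)) = r + 1 - dim Ī_1`.

## References

* [Hartshorne1977] R. Hartshorne, *Algebraic Geometry*, GTM 52, Springer 1977, II Ex. 5.10, 5.14 (d)
  (pp. 125–126), III Ex. 5.5 (a) (p. 231), III Thm. 5.1 (p. 225).
* [OkonekSchneiderSpindler1980] C. Okonek, M. Schneider, H. Spindler, *Vector Bundles on Complex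
  Projective Spaces*, Birkhäuser 1980, Ch. I §1.1 (p. 8): `h⁰(ℙ_n, 𝒪(k)) = C(n+k, k)`.
-/

noncomputable section

open CategoryTheory CategoryTheory.Limits

universe u

namespace Literature.Algebra.Homology

namespace LaurentCech

open OrderedCech TopCohomology

variable {k : Type u} [Field k] {r : ℕ} {J : Type} [Fintype J] (e : J → ℤ)

/-- **`h¹(Č_d(K)) + dim (F_e)_d = h⁰(Č_d(F_e ⧸ K)) + dim K̄_d`** (`r ≥ 2`, `K` graded, `k` a field,
every `d`): `H¹(K~(d))` is the cokernel of `H⁰(F_e(d)) → H⁰((F_e⧸K)~(d))`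
(`nonempty_quotient_range_linearEquiv_homology_one`), whose image is that of
`α_d : (F_e)_d → H⁰((F_e⧸K)~(d))` with kernel `K̄_d` (`ker_alphaH0`).
[cite: Hartshorne1977, III Ex. 5.5 (a) (p. 231)] [cite: Hartshorne1977, II Ex. 5.14 (d) (p. 126)]
[cite: Hartshorne1977, II Ex. 5.10 (p. 125)] -/
theorem finrank_homology_cech_one_add (hr : 2 ≤ r) {K : Submodule (P k r) (J → P k r)}
    (hK : IsGraded e K) (d : ℤ) :
    Module.finrank k ((cech e K d).homology 1) +
        Module.finrank k (∀ j, (Ldeg k r (d - e j)).comap (toL k r).toLinearMap) =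
      Module.finrank k ((quot e K d).homology 0) + Module.finrank k (degPiece e (sat K) d) := by
  have hr1 : 1 ≤ r := one_le_two.trans hr
  haveI : ∀ j, Module.Finite k ((Ldeg k r (d - e j)).comap (toL k r).toLinearMap) := fun j =>
    moduleFinite_comap_toL_Ldeg _
  haveI : Module.Finite k ((quot e K d).homology 0) := moduleFinite_homology_quot e hK d 0
  obtain ⟨Φ⟩ := nonempty_quotient_range_linearEquiv_homology_one e K d hr
  -- `h¹ = h⁰(quot) - rk(H⁰ π)`
  have h1 : Module.finrank k ((cech e K d).homology 1) + Module.finrank k (LinearMap.range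
      (HomologicalComplex.homologyMap (cokernel.π (inclusion e K ⊤ le_top d)) 0).hom) =
      Module.finrank k ((quot e K d).homology 0) := by
    rw [← Φ.finrank_eq]
    exact Submodule.finrank_quotient_add_finrank _
  -- `rk(H⁰ π) = rk(α_d)`
  have hrange : LinearMap.range (alphaH0 e K hr1 d) = LinearMap.range
      (HomologicalComplex.homologyMap (cokernel.π (inclusion e K ⊤ le_top d)) 0).hom := by
    change LinearMap.range ((HomologicalComplex.homologyMap
      (cokernel.π (inclusion e K ⊤ le_top d)) 0).hom ∘ₗ
        (globalSectionsEquivFree e hr1 d).symm.toLinearMap) = _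
    exact LinearMap.range_comp_of_range_eq_top _ (LinearEquiv.range _)
  -- `rk(α_d) + dim K̄_d = dim (F_e)_d`
  have h2 : Module.finrank k (LinearMap.range
      (HomologicalComplex.homologyMap (cokernel.π (inclusion e K ⊤ le_top d)) 0).hom) +
      Module.finrank k (degPiece e (sat K) d) =
      Module.finrank k (∀ j, (Ldeg k r (d - e j)).comap (toL k r).toLinearMap) := by
    have h := LinearMap.finrank_range_add_finrank_ker (alphaH0 e K hr1 d)
    rw [ker_alphaH0, hrange] at h
    exact h
  omega

/-- Reformulation: **`h¹(Č_d(K)) = h⁰(Č_d(F_e ⧸ K)) - (dim (F_e)_d - dim K̄_d)`** as integers.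
[cite: Hartshorne1977, III Ex. 5.5 (a) (p. 231)] [cite: Hartshorne1977, II Ex. 5.14 (d) (p. 126)] -/
theorem finrank_homology_cech_one_eq_sub (hr : 2 ≤ r) {K : Submodule (P k r) (J → P k r)}
    (hK : IsGraded e K) (d : ℤ) :
    (Module.finrank k ((cech e K d).homology 1) : ℤ) =
      Module.finrank k ((quot e K d).homology 0) -
        ((Module.finrank k (∀ j, (Ldeg k r (d - e j)).comap (toL k r).toLinearMap) : ℤ) -
          Module.finrank k (degPiece e (sat K) d)) := by
  have h := finrank_homology_cech_one_add e hr hK d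
  omega

/-- **`h¹(𝓘_X(d)) + C(d + r, r) = h⁰(𝒪_X(d)) + dim Ī_d`** for a closed subscheme `X = V(I) ⊆ ℙ^r_k`
(`I ⊆ S = k[x_0, …, x_r]` a graded submodule, `J = Unit`, `e = 0`), `r ≥ 2`, `d ≥ 0`; the defect
`h¹(𝓘_X(d))` counts the sections of `𝒪_X(d)` not cut out by forms of degree `d`
(`dim S_d = C(d + r, r)`). [cite: Hartshorne1977, III Ex. 5.5 (a) (p. 231)]
[cite: Hartshorne1977, II Ex. 5.14 (d) (p. 126)] [cite: OkonekSchneiderSpindler1980, Ch. I § 1.1 (p. 8)] -/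
theorem finrank_homology_cech_one_add_choose (hr : 2 ≤ r) {I : Submodule (P k r) (Unit → P k r)}
    (hI : IsGraded (fun _ : Unit => (0 : ℤ)) I) {d : ℤ} (hd : 0 ≤ d) :
    Module.finrank k ((cech (fun _ : Unit => (0 : ℤ)) I d).homology 1) + (d.toNat + r).choose r =
      Module.finrank k ((quot (fun _ : Unit => (0 : ℤ)) I d).homology 0) +
        Module.finrank k (degPiece (fun _ : Unit => (0 : ℤ)) (sat I) d) := by
  have h := finrank_homology_cech_one_add (fun _ : Unit => (0 : ℤ)) hr hI d
  haveI : ∀ _ : Unit, Module.Finite k ((Ldeg k r (d - (fun _ : Unit => (0 : ℤ)) ())).comap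
      (toL k r).toLinearMap) := fun _ => moduleFinite_comap_toL_Ldeg _
  have hF : Module.finrank k (∀ _ : Unit, (Ldeg k r (d - (fun _ : Unit => (0 : ℤ)) ())).comap
      (toL k r).toLinearMap) = (d.toNat + r).choose r := by
    rw [Module.finrank_pi_fintype, Fintype.sum_unique]
    change Module.finrank k ((Ldeg k r (d - 0)).comap (toL k r).toLinearMap) = _
    rw [sub_zero, finrank_comap_toL_Ldeg, if_pos hd]
  rw [hF] at h
  exact h

end LaurentCech

end Literature.Algebra.Homology

end
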